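import Summits.AtomisticToContinuum.BoseEinsteinCondensation.Theses.BECSwapNoCatastrophe
import Literature.MathematicalPhysics.QuantumManyBody.PeriodicBoseGasTagged
import HarnessLib

/-!
# Crux `TorusHalfSwapOverlap` (stmt-AtomisticToContinuum-14393), line `birth`, stub `stub_chordOfPath`

Route `BECSwapNoCatastrophe` (sub-problem `BoseEinsteinCondensation`). Glue stub: the route's rank-3 item `TorusSwapPathRigidity` (stmt-AtomisticToContinuum-14394, by name) implies the bounded-`v` chord claim `BoundedChord` of the line: instance `(s, s') = (1/2, 0)`, `ε = 1`, `τ = 1/8` after identifying the inlined forms pointwise.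

This file proves the REGISTERED stub signature verbatim (tree vocabulary, the two-copy objects inlined as
`let`s exactly as in the route decls), under the registered name, in the line's namespace; it cannot import
the `Cruxes/` skeleton, which reads it back definitionally.

* `ChordOfPath.glue` — the instantiation `ε = 1`, `(s, s') = (1/2, 0)`, `τ = 1/8`, abstract in the
  path of forms `E2`, its endpoints `E2z = E2 0`, `E2h = E2 (1/2)`, the class `Adm` and the overlap.
* `ChordOfPath.sum_half_eq`, `ChordOfPath.tail_add_sum_zero_eq` — the pointwise identities of the
  interaction weights at `s = 1/2` (`ofReal (1/2) = 2⁻¹`) and `s = 0` (splitting the pair sum at the tag,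
  `periodicInteraction_succ`).
* `ChordOfPath.lintegral_half_eq`, `ChordOfPath.lintegral_zero_eq` — the resulting identities of forms.
* `stub_chordOfPath` — the registered stub.
-/

noncomputable section

open MeasureTheory Filter
open scoped ENNReal NNReal BigOperators ComplexConjugate

namespace Summit.AtomisticToContinuum.BoseEinsteinCondensation.Cruxes.TorusHalfSwapOverlap.Birth

open Literature.MathematicalPhysics.QuantumManyBody.BoseGas
open Summit.AtomisticToContinuum.BoseEinsteinCondensation.Theses.BECSwapNoCatastrophe (TorusSwapPathRigidity)

/-! ### Helper lemmas (keep them `private` or inside `namespace ChordOfPath … end ChordOfPath`) -/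

namespace ChordOfPath

/-- **Abstract chord of the path.** If along a path of functionals `E2 s` (`s ∈ [0, 1]`) over a class
`Adm` the `δ`-near-minimisers `Θ` of `E2 s` and `Θ'` of `E2 s'` have overlap
`ip Θ Θ' ≥ 1 - 1 · (s - s')² - τ` (for every `τ > 0`, some `δ = δ(s, s', τ) > 0`), then for the
endpoints `E2h = E2 (1/2)` and `E2z = E2 0` there is `δ > 0` such that `δ`-near-minimisers `Θ` of
`E2h` and `Φ` of `E2z` satisfy `ip Θ Φ ≥ 1/2 + 1/8` (take `τ = 1/8`: `1 - 1/4 - 1/8 = 5/8`). [folklore] -/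
theorem glue {α : Type*} {E2 : ℝ → (α → ℂ) → ℝ≥0∞} {E2z E2h : (α → ℂ) → ℝ≥0∞}
    {Adm : (α → ℂ) → Prop} {ip : (α → ℂ) → (α → ℂ) → ℝ≥0∞}
    (hn : ∀ s : ℝ, 0 ≤ s → s ≤ 1 → ∀ s' : ℝ, 0 ≤ s' → s' ≤ 1 → ∀ τ : ℝ, 0 < τ →
      ∃ δ : ℝ≥0∞, 0 < δ ∧ ∀ Θ Θ' : α → ℂ, Adm Θ → Adm Θ' →
        E2 s Θ ≤ (⨅ (Θ'' : α → ℂ) (_ : Adm Θ''), E2 s Θ'') + δ →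
        E2 s' Θ' ≤ (⨅ (Θ'' : α → ℂ) (_ : Adm Θ''), E2 s' Θ'') + δ →
        ENNReal.ofReal (1 - 1 * (s - s') ^ 2 - τ) ≤ ip Θ Θ')
    (hhalf : ∀ Θ : α → ℂ, E2 (1 / 2) Θ = E2h Θ) (hzero : ∀ Θ : α → ℂ, E2 0 Θ = E2z Θ) :
    ∃ δ : ℝ≥0∞, 0 < δ ∧ ∀ Φ Θ : α → ℂ,
      Adm Φ → E2z Φ ≤ (⨅ (Θ' : α → ℂ) (_ : Adm Θ'), E2z Θ') + δ →
      Adm Θ → E2h Θ ≤ (⨅ (Θ' : α → ℂ) (_ : Adm Θ'), E2h Θ') + δ →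
      ENNReal.ofReal (1 / 2 + 1 / 8) ≤ ip Θ Φ := by
  obtain ⟨δ, hδ, hmain⟩ :=
    hn (1 / 2) (by norm_num) (by norm_num) 0 le_rfl zero_le_one (1 / 8) (by norm_num)
  refine ⟨δ, hδ, fun Φ Θ hΦ hΦE hΘ hΘE => ?_⟩
  simp only [hhalf, hzero] at hmain
  have h58 : (1 : ℝ) - 1 * (1 / 2 - 0) ^ 2 - 1 / 8 = 1 / 2 + 1 / 8 := by norm_num
  rw [h58] at hmain
  exact hmain Θ Φ hΘ hΦ hΘE hΦE

/-- **The weights at the midpoint `s = 1/2`**: `(1 - 1/2)(A + B) + (1/2)(C + D) = ½ (A + B + C + D)`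
in `[0, ∞]` (`ENNReal.ofReal (1/2) = 2⁻¹`), summed over the bath particles. [folklore] -/
theorem sum_half_eq (v : ℝ → ℝ≥0∞) (L : ℝ) {n : ℕ} (Z : Config (n + 1) × Config (n + 1)) :
    (∑ j : Fin n, (ENNReal.ofReal (1 - 1 / 2) *
        (periodizedPotential v L (Z.1 0 - Z.1 j.succ) + periodizedPotential v L (Z.2 0 - Z.2 j.succ)) +
      ENNReal.ofReal (1 / 2) *
        (periodizedPotential v L (Z.2 0 - Z.1 j.succ) + periodizedPotential v L (Z.1 0 - Z.2 j.succ)))) =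
    ∑ j : Fin n, (2 : ENNReal)⁻¹ * (periodizedPotential v L (Z.1 0 - Z.1 j.succ) +
      periodizedPotential v L (Z.2 0 - Z.2 j.succ) + periodizedPotential v L (Z.2 0 - Z.1 j.succ) +
      periodizedPotential v L (Z.1 0 - Z.2 j.succ)) := by
  have h2 : ENNReal.ofReal (1 / 2) = 2⁻¹ := by
    rw [one_div, ENNReal.ofReal_inv_of_pos two_pos, ENNReal.ofReal_ofNat]
  have h1 : ENNReal.ofReal (1 - 1 / 2) = 2⁻¹ := by
    rw [← h2]
    norm_num
  refine Finset.sum_congr rfl fun j _ => ?_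
  rw [h1, h2, ← mul_add, ← add_assoc]

/-- **The weights at the endpoint `s = 0`** recombine with the bath–bath interactions to the full
pair interactions of the two copies: `V(X̂) + V(Ŷ) + ∑_j (1·(v(a - x_j) + v(b - y_j)) + 0·(…)) =
V(X) + V(Y)` (splitting the pair sum at the tag, `periodicInteraction_succ`; `0 · ⊤ = 0`). [folklore] -/
theorem tail_add_sum_zero_eq (v : ℝ → ℝ≥0∞) (L : ℝ) {n : ℕ} (Z : Config (n + 1) × Config (n + 1)) :
    periodicInteraction v L (Fin.tail Z.1) + periodicInteraction v L (Fin.tail Z.2) +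
      ∑ j : Fin n, (ENNReal.ofReal (1 - 0) *
          (periodizedPotential v L (Z.1 0 - Z.1 j.succ) + periodizedPotential v L (Z.2 0 - Z.2 j.succ)) +
        ENNReal.ofReal 0 *
          (periodizedPotential v L (Z.2 0 - Z.1 j.succ) + periodizedPotential v L (Z.1 0 - Z.2 j.succ))) =
    periodicInteraction v L Z.1 + periodicInteraction v L Z.2 := by
  have hs : ∀ X : Config (n + 1), periodicInteraction v L X =
      (∑ j : Fin n, periodizedPotential v L (X 0 - X j.succ)) + periodicInteraction v L (Fin.tail X) :=
    fun X => periodicInteraction_succ v L X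
  simp only [sub_zero, ENNReal.ofReal_one, one_mul, ENNReal.ofReal_zero, zero_mul, add_zero,
    Finset.sum_add_distrib]
  rw [hs Z.1, hs Z.2]
  ring

/-- **The midpoint of the path is the half-swapped form**: `E2 (1/2) = E2h` (the two-copy form with
each tagged particle coupled at half strength to both baths), as an identity of the defining
integrals over any two-copy region `C2`. [folklore] -/
theorem lintegral_half_eq (v : ℝ → ℝ≥0∞) (L : ℝ) {n : ℕ} (C2 : Set (Config (n + 1) × Config (n + 1)))
    (Θ : Config (n + 1) × Config (n + 1) → ℂ) :
    (∫⁻ Z in C2, (kineticDensity (fun X => Θ (X, Z.2)) Z.1 + kineticDensity (fun Y => Θ (Z.1, Y)) Z.2 +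
      (periodicInteraction v L (Fin.tail Z.1) + periodicInteraction v L (Fin.tail Z.2) +
        ∑ j : Fin n, (ENNReal.ofReal (1 - 1 / 2) *
            (periodizedPotential v L (Z.1 0 - Z.1 j.succ) + periodizedPotential v L (Z.2 0 - Z.2 j.succ)) +
          ENNReal.ofReal (1 / 2) *
            (periodizedPotential v L (Z.2 0 - Z.1 j.succ) + periodizedPotential v L (Z.1 0 - Z.2 j.succ)))) *
        (‖Θ Z‖₊ : ENNReal) ^ 2)) =
    ∫⁻ Z in C2, (kineticDensity (fun X => Θ (X, Z.2)) Z.1 + kineticDensity (fun Y => Θ (Z.1, Y)) Z.2 +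
      (periodicInteraction v L (Fin.tail Z.1) + periodicInteraction v L (Fin.tail Z.2) +
        ∑ j : Fin n, (2 : ENNReal)⁻¹ * (periodizedPotential v L (Z.1 0 - Z.1 j.succ) +
          periodizedPotential v L (Z.2 0 - Z.2 j.succ) + periodizedPotential v L (Z.2 0 - Z.1 j.succ) +
          periodizedPotential v L (Z.1 0 - Z.2 j.succ))) * (‖Θ Z‖₊ : ENNReal) ^ 2) := by
  simp only [sum_half_eq]

/-- **The endpoint `s = 0` of the path is the decoupled two-copy form**: `E2 0 = E2z = E ⊕ E`
(full pair interactions inside each copy, no cross terms), as an identity of the defining integrals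
over any two-copy region `C2`. [folklore] -/
theorem lintegral_zero_eq (v : ℝ → ℝ≥0∞) (L : ℝ) {n : ℕ} (C2 : Set (Config (n + 1) × Config (n + 1)))
    (Θ : Config (n + 1) × Config (n + 1) → ℂ) :
    (∫⁻ Z in C2, (kineticDensity (fun X => Θ (X, Z.2)) Z.1 + kineticDensity (fun Y => Θ (Z.1, Y)) Z.2 +
      (periodicInteraction v L (Fin.tail Z.1) + periodicInteraction v L (Fin.tail Z.2) +
        ∑ j : Fin n, (ENNReal.ofReal (1 - 0) *
            (periodizedPotential v L (Z.1 0 - Z.1 j.succ) + periodizedPotential v L (Z.2 0 - Z.2 j.succ)) +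
          ENNReal.ofReal 0 *
            (periodizedPotential v L (Z.2 0 - Z.1 j.succ) + periodizedPotential v L (Z.1 0 - Z.2 j.succ)))) *
        (‖Θ Z‖₊ : ENNReal) ^ 2)) =
    ∫⁻ Z in C2, kineticDensity (fun X => Θ (X, Z.2)) Z.1 + kineticDensity (fun Y => Θ (Z.1, Y)) Z.2 +
      (periodicInteraction v L Z.1 + periodicInteraction v L Z.2) * (‖Θ Z‖₊ : ENNReal) ^ 2 := by
  simp only [tail_add_sum_zero_eq]

end ChordOfPath

/-! ### The registered stub -/

/-- **Rank 3 ⇒ the bounded chord** (`stub_chordOfPath`, registered signature). [folklore] -/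
theorem stub_chordOfPath :
    TorusSwapPathRigidity →
      ∀ v : ℝ → ℝ≥0∞, IsRepulsiveFiniteRange v → (∃ M : NNReal, ∀ r, v r ≤ M) →
        ∃ ρ₀ : ℝ, 0 < ρ₀ ∧ ∀ ρ : ℝ, 0 < ρ → ρ < ρ₀ → ∃ η : ℝ, 0 < η ∧ ∀ᶠ n : ℕ in atTop,
          let L : ℝ := sideLength ρ (n + 1)
          let C2 : Set (Config (n + 1) × Config (n + 1)) := (cellN (n + 1) L) ×ˢ (cellN (n + 1) L)
          let E2z : (Config (n + 1) × Config (n + 1) → ℂ) → ℝ≥0∞ := fun Θ => ∫⁻ Z in C2,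
            kineticDensity (fun X => Θ (X, Z.2)) Z.1 + kineticDensity (fun Y => Θ (Z.1, Y)) Z.2 +
              (periodicInteraction v L Z.1 + periodicInteraction v L Z.2) * (‖Θ Z‖₊ : ENNReal) ^ 2
          let E2h : (Config (n + 1) × Config (n + 1) → ℂ) → ℝ≥0∞ := fun Θ => ∫⁻ Z in C2,
            (kineticDensity (fun X => Θ (X, Z.2)) Z.1 + kineticDensity (fun Y => Θ (Z.1, Y)) Z.2 +
              (periodicInteraction v L (Fin.tail Z.1) + periodicInteraction v L (Fin.tail Z.2) +
                ∑ j : Fin n, (2 : ENNReal)⁻¹ * (periodizedPotential v L (Z.1 0 - Z.1 j.succ) +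
                  periodizedPotential v L (Z.2 0 - Z.2 j.succ) + periodizedPotential v L (Z.2 0 - Z.1 j.succ) +
                  periodizedPotential v L (Z.1 0 - Z.2 j.succ))) * (‖Θ Z‖₊ : ENNReal) ^ 2)
          let Adm : (Config (n + 1) × Config (n + 1) → ℂ) → Prop := fun Θ => ContDiff ℝ 1 Θ ∧
            (∀ (Z : Config (n + 1) × Config (n + 1)) (i : Fin (n + 1)) (k : Fin 3),
              Θ (Z.1 + Pi.single i (EuclideanSpace.single k L), Z.2) = Θ Z ∧
                Θ (Z.1, Z.2 + Pi.single i (EuclideanSpace.single k L)) = Θ Z) ∧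
            ∫⁻ Z in C2, (‖Θ Z‖₊ : ENNReal) ^ 2 = 1
          ∃ δ : ℝ≥0∞, 0 < δ ∧ ∀ Φ Θ : Config (n + 1) × Config (n + 1) → ℂ,
            Adm Φ → E2z Φ ≤ (⨅ (Θ' : Config (n + 1) × Config (n + 1) → ℂ) (_ : Adm Θ'), E2z Θ') + δ →
            Adm Θ → E2h Θ ≤ (⨅ (Θ' : Config (n + 1) × Config (n + 1) → ℂ) (_ : Adm Θ'), E2h Θ') + δ →
            ENNReal.ofReal (1 / 2 + η) ≤ (‖∫ Z in C2, (starRingEnd ℂ) (Θ Z) * Φ Z‖₊ : ENNReal) ^ 2 := by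
  intro hPR v hv hb
  obtain ⟨ρ₀, hρ₀, H⟩ := hPR v hv hb 1 one_pos
  refine ⟨ρ₀, hρ₀, fun ρ hρ hlt => ⟨1 / 8, by norm_num, ?_⟩⟩
  filter_upwards [H ρ hρ hlt] with n hn
  exact ChordOfPath.glue hn (ChordOfPath.lintegral_half_eq v (sideLength ρ (n + 1)) _)
    (ChordOfPath.lintegral_zero_eq v (sideLength ρ (n + 1)) _)

end Summit.AtomisticToContinuum.BoseEinsteinCondensation.Cruxes.TorusHalfSwapOverlap.Birth

end
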